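import Summits.Langlands.Langlands.Theorems.CoreAdequacySplitNoAdequateLayerLiftingStubCoprimeTableLiftingRankTwoPrelim

/-!
# RSL `CoreAdequacySplit.NoAdequateLayerLifting` (stmt-Langlands-27954), line `birth`, stub 3/3 `stub_coprimeTableLifting` — STRUCTURAL HELPERS, part 3c:
# on the RANK-TWO ROWS the projective image has NO non-trivial normal `ℓ`-subgroup (classification-free)

Part 3a showed: on a rank-two coprime row (¬SADQ, `τ` an absolutely irreducible reduction over `K(ζ_ℓ)`, `ℓ` odd) the projective image
`H ≤ PGL₂(𝔽̄_ℓ)` of `τ` is finite, `ℓ`-irregular and fixes no point of `ℙ¹(𝔽̄_ℓ)`.  The landed, classification-free part I of the Dickson series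
(`PGL2.exists_forall_smul_eq_of_normal`, Faber Cor. 4.10: a non-trivial NORMAL `p`-subgroup forces a common fixed point) then gives, with no appeal
to Dickson's theorem (part 3b, pending on the farm): `H` has no non-trivial normal `ℓ`-subgroup (`O_ℓ(H) = 1`), its Sylow `ℓ`-subgroups are NOT
normal (so there are at least `ℓ + 1` of them and `H` is not `ℓ`-nilpotent) — the «Borel» branch `P ◁ H` of Dickson's dichotomy is excluded
unconditionally.  No new definition; 0 sorry.
-/

set_option linter.dupNamespace false

namespace Summit.Langlands.Langlands.Theorems.CoreAdequacy.CoprimeTable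

open scoped MatrixGroups Pointwise
open Literature.NumberTheory.GaloisRepresentations
open Literature.GroupTheory.SpecificGroups
open Summit.Langlands.Langlands.Theses

universe u

section RankTwoGroup

variable {k : Type u} [Field k] [DecidableEq k]

/-- **No non-trivial normal `ℓ`-subgroup in the projective image of an absolutely irreducible `τ : G → GL₂(k̄)`** (`char k = ℓ`): such a subgroup
would fix a common point of `ℙ¹` (landed `PGL2.exists_forall_smul_eq_of_normal`), i.e. a common eigenline (part 3a). -/
theorem eq_bot_of_normal_isPGroup_projectiveImage [IsAlgClosed k] {ℓ : ℕ} [Fact ℓ.Prime] [CharP k ℓ] {G : Type*} [Group G]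
    {τ : G →* GL (Fin 2) k} (hirr : IsAbsIrreducible τ) [Finite (projectiveImage τ)] (N : Subgroup (projectiveImage τ)) [N.Normal]
    (hN : IsPGroup ℓ N) : N = ⊥ := by
  by_contra hN1
  exact not_exists_forall_smul_eq_of_isAbsIrreducible hirr (PGL2.exists_forall_smul_eq_of_normal ℓ (projectiveImage τ) N hN hN1)

/-- **The Sylow `ℓ`-subgroups of the projective image are not normal** (absolutely irreducible `τ : G → GL₂(k̄)`, `ℓ ∣ |projective image|`). -/
theorem not_normal_sylow_projectiveImage [IsAlgClosed k] {ℓ : ℕ} [Fact ℓ.Prime] [CharP k ℓ] {G : Type*} [Group G]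
    {τ : G →* GL (Fin 2) k} (hirr : IsAbsIrreducible τ) [Finite (projectiveImage τ)] (hdvd : ℓ ∣ Nat.card (projectiveImage τ))
    (P : Sylow ℓ (projectiveImage τ)) : ¬ (P : Subgroup (projectiveImage τ)).Normal := by
  intro hP
  haveI := hP
  exact not_exists_forall_smul_eq_of_isAbsIrreducible hirr (PGL2.exists_forall_smul_eq_of_sylow_normal ℓ (projectiveImage τ) P hdvd)

end RankTwoGroup

/-! ## The rank-two rows of the residual table -/

section Table

variable {K : Type} [Field K] [NumberField K] {ℓ : ℕ} [Fact ℓ.Prime]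

/-- **RANK-TWO ROWS: `O_ℓ(projective image) = 1` and the Sylow `ℓ`-subgroups of the projective image are not normal** (ℓ odd, ¬SADQ, `τ` an
absolutely irreducible reduction over `K(ζ_ℓ)`) — the Borel branch of Dickson's dichotomy is excluded without the classification. -/
theorem rank_two_row_sylow [DecidableEq (padicAlgClResidueField ℓ)] (hℓ2 : ¬ ℓ ∣ 2) {ρ : FramedGaloisRep K (PadicAlgCl ℓ) 2}
    (hN : ¬ SolvablyAdequateImage ρ) {τ : Field.absoluteGaloisGroup (CyclotomicField ℓ K) →* GL (Fin 2) (padicAlgClResidueField ℓ)}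
    (hτ : (ρ.restrictField (CyclotomicField ℓ K)).IsReductionOf (RingHom.id _) τ) (hirr : IsAbsIrreducible τ) :
    ∃ _ : Finite (projectiveImage τ), ℓ ∣ Nat.card (projectiveImage τ) ∧
      (∀ N : Subgroup (projectiveImage τ), N.Normal → IsPGroup ℓ N → N = ⊥) ∧
      ∀ P : Sylow ℓ (projectiveImage τ), ¬ (P : Subgroup (projectiveImage τ)).Normal := by
  haveI : IsAlgClosed (padicAlgClResidueField ℓ) := Literature.RingTheory.Valuation.isAlgClosed_residueField (padicAlgClIntegers ℓ)
  haveI := charP_padicAlgClResidueField ℓ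
  obtain ⟨hfin, hdvd, -⟩ := rank_two_row_dickson_hypotheses hℓ2 hN hτ hirr
  haveI := hfin
  exact ⟨hfin, hdvd, fun N hNn hNp => by haveI := hNn; exact eq_bot_of_normal_isPGroup_projectiveImage hirr N hNp,
    fun P => not_normal_sylow_projectiveImage hirr hdvd P⟩

end Table

end Summit.Langlands.Langlands.Theorems.CoreAdequacy.CoprimeTable
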